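import Summits.QuantumFields.YangMills.Theorems.ColdStartUniversalityLatticeLangevinLiebRobinsonCorrelationLightConePointwise
import Summits.QuantumFields.YangMills.Theorems.ColdStartUniversalityLatticeLangevinLiebRobinsonWordLightCone
import Summits.QuantumFields.YangMills.Theorems.ColdStartUniversalityLatticeLangevinLiebRobinsonDynamicClustering
import HarnessLib

/-!
# Route `ColdStartUniversality` (fixed-cut-off SZZ dynamics; LIEB–ROBINSON / LOCALITY package, file 36):
# ★★★ WILSON LOOPS FROM THE COLD START — correlations live inside the light cone (every coupling); and
# ★★★ UNIFORM-IN-TIME DYNAMIC CLUSTERING FROM A DETERMINISTIC START at `|β'| < 1/12`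

Helper file (seat `ym-line-csu-p1`, g32; `--supports stmt-QuantumFields-24809`).  Consequences of the correlation light cone (files 34–35)
for the `SU(2)` lattice Langevin dynamics of Shen–Zhu–Zhu on `(ℤ/L)³`:
* ★★★ `wilson_loop_transition_covariance_abs_le_lightCone`, `wilson_loop_solution_covariance_abs_le_lightCone` — for loop words `w₁, w₂` at
  cyclic sup-distance `≥ R+1`, EVERY coupling, every volume, every start `x` (resp. every strong solution from a deterministic start, e.g. the
  COLD START): `|E[Re tr w₁(U_t)·Re tr w₂(U_t)] − E[Re tr w₁(U_t)]E[Re tr w₂(U_t)]| ≤ 384π²|w₁|²|w₂|²·t·e^(2λt)·2^(−(R+1))`, `λ = (1300+4√2)|β'|`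
  — two distant Wilson loops become correlated only after their light cones meet;
* `cube_add_two_mul_exp_neg_le`, `crossover_bound_of_two_regimes` — real-variable bookkeeping of the crossover between the light-cone regime
  (small `t`, file 35) and the mixing regime (large `t`, file 18, `|β'| < 1/12`);
* ★★★ `transition_covariance_abs_le_uniform_of_separated` — `|β'| < 1/12`: for `C⁵` observables with profiles on link sets at distance `≥ R+1`,
  EVERY start, EVERY time: `|κ_t(FG)(x) − κ_tF(x)κ_tG(x)| ≤ (96t⋆Σℓ^FΣℓ^G + 8Σℓ^FΣℓ^G(1+T_R) + 12π(27(1+6(λ+ρ)/ρ)³+2)Amp)·e^(−ρt⋆/2)`,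
  `t⋆ = (R+1) log 2/(2λ+ρ)`, `ρ = 1 − 12|β'|` — exponentially small in the separation, with NO volume factor and NO time dependence: along the
  cold-start evolution at strong coupling distant local observables are NEVER correlated (the product structure of the start is carried into the
  clustering of the equilibrium without an intermediate build-up).
THEOREMS ONLY, no definition, no sorry; [folklore].  HONEST FRAMING: fixed cut-off; §1 holds at every coupling but the cone slope `λ ∝ |β'|` is
NOT `K`-uniform in physical units along `β'_K = (γε_K)⁻¹/2 → ∞`; §2 needs the strong-coupling window `|β'| < 1/12`, which the route's scaling
leaves; `UniformColdStartMixing` (24809) is NOT restated; no crux, rung or summit statement is proved; the Yang–Mills mass gap is NOT proved.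
-/

set_option autoImplicit false

noncomputable section

namespace Summit.QuantumFields.YangMills.Theorems.ColdStartUniversality.LiebRobinson

open MeasureTheory ProbabilityTheory Matrix Complex Finset Filter Set Metric intervalIntegral
open scoped ComplexConjugate BigOperators Matrix NNReal ENNReal Topology
open Literature.Probability.Process Literature.MathematicalPhysics.QuantumFieldTheory
open Literature.MathematicalPhysics.QuantumFieldTheory.Balaban1983to89
open Literature.MathematicalPhysics.QuantumLattice (fundamentalRep fundamentalLatticeRep continuous_fundamentalRep fundamentalRep_apply)

variable {L : ℕ} [NeZero L]

/-! ## §1. Wilson loops from a deterministic start: loop–loop correlations are created inside the light cone only -/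

/-- ★★★ **Wilson loops along the dynamics from EVERY deterministic start (every coupling `β'`, every volume `L`).**  For two loop words
`w₁, w₂` (lists of oriented links) whose links have base sites at cyclic sup-distance `≥ R+1`, every realising Markov kernel family `κ`, every
lattice time `t` and EVERY start `x` (e.g. the cold start):
`|κ_t(Re tr w₁ · Re tr w₂)(x) − κ_t(Re tr w₁)(x)·κ_t(Re tr w₂)(x)| ≤ 384π²·|w₁|²·|w₂|²·t·e^(2λt)·2^(−(R+1))`, `λ = (1300+4√2)|β'|`
(`transition_covariance_abs_le_lightCone_of_separated` with the word profiles `2π|w|` on the links of `w`, `word_linkLipschitz_profile`).  Started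
from a point, two Wilson loops remain uncorrelated until their light cones (slope `2λ/log 2` links per unit lattice time) meet; no volume
factor, no small-coupling window.  Fixed cut-off; the Yang–Mills mass gap is NOT proved. [folklore] -/
theorem wilson_loop_transition_covariance_abs_le_lightCone (L : ℕ) [NeZero L] (β' : ℝ)
    (κ : ℝ≥0 → Kernel (GaugeConfig 3 L (Matrix.specialUnitaryGroup (Fin 2) ℂ))
      (GaugeConfig 3 L (Matrix.specialUnitaryGroup (Fin 2) ℂ))) [∀ t, IsMarkovKernel (κ t)]
    (hreal : ∀ (t : ℝ≥0) (x : GaugeConfig 3 L (Matrix.specialUnitaryGroup (Fin 2) ℂ))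
        (Ω : Type) [MeasurableSpace Ω] (P : Measure Ω) [IsProbabilityMeasure P]
        (W : ℝ≥0 → Ω → (Edge 3 L × NoiseIdx 2 → ℝ)) (hW : IsFlatBrownian W P)
        (U : ℝ≥0 → Ω → GaugeConfig 3 L (Matrix.specialUnitaryGroup (Fin 2) ℂ)),
        (∀ ω, U 0 ω = x) →
        (latticeLangevinDynamics (fundamentalLatticeRep 2) β').IsSolution (fundamentalRep (Fin 2))
          hW.natFiltration P W U →
        κ t x = P.map (U t))
    (l₁ l₂ : List (Edge 3 L × Bool)) (R : ℕ)
    (hsep : ∀ e' ∈ (l₁.map Prod.fst).toFinset, ∀ e ∈ (l₂.map Prod.fst).toFinset, R + 1 ≤ (Finset.univ.sup fun i : Fin 3 => ((e'.1 i - e.1 i).valMinAbs).natAbs))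
    (t : ℝ≥0) (x : (GaugeConfig 3 L (Matrix.specialUnitaryGroup (Fin 2) ℂ))) :
    let coords : GaugeConfig 3 L (Matrix.specialUnitaryGroup (Fin 2) ℂ) → (Edge 3 L × Fin 2 × Fin 2 × Bool → ℝ) :=
      fun V q => (fun z : ℂ => if q.2.2.2 then z.im else z.re)
        ((fundamentalRep (Fin 2) (V q.1) : Matrix (Fin 2) (Fin 2) ℂ) q.2.1 q.2.2.1)
    |(∫ y, (fun y : (Edge 3 L × Fin 2 × Fin 2 × Bool → ℝ) => ((l₁.map (fun a : Edge 3 L × Bool => if a.2 then ((fun (ee : Edge 3 L) => Matrix.of fun (i j : Fin 2) => ((y (ee, i, j, false) : ℝ) : ℂ) + ((y (ee, i, j, true) : ℝ) : ℂ) * Complex.I) a.1)ᴴ else (fun (ee : Edge 3 L) => Matrix.of fun (i j : Fin 2) => ((y (ee, i, j, false) : ℝ) : ℂ) + ((y (ee, i, j, true) : ℝ) : ℂ) * Complex.I) a.1)).prod).trace.re) (coords y) * (fun y : (Edge 3 L × Fin 2 × Fin 2 × Bool → ℝ) => ((l₂.map (fun a : Edge 3 L × Bool => if a.2 then ((fun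 (ee : Edge 3 L) => Matrix.of fun (i j : Fin 2) => ((y (ee, i, j, false) : ℝ) : ℂ) + ((y (ee, i, j, true) : ℝ) : ℂ) * Complex.I) a.1)ᴴ else (fun (ee : Edge 3 L) => Matrix.of fun (i j : Fin 2) => ((y (ee, i, j, false) : ℝ) : ℂ) + ((y (ee, i, j, true) : ℝ) : ℂ) * Complex.I) a.1)).prod).trace.re) (coords y) ∂(κ t x)) -
        (∫ y, (fun y : (Edge 3 L × Fin 2 × Fin 2 × Bool → ℝ) => ((l₁.map (fun a : Edge 3 L × Bool => if a.2 then ((fun (ee : Edge 3 L) => Matrix.of fun (i j : Fin 2) => ((y (ee, i, j, false) : ℝ) : ℂ) + ((y (ee, i, j, true) : ℝ) : ℂ) * Complex.I) a.1)ᴴ else (fun (ee : Edge 3 L) => Matrix.of fun (i j : Fin 2) => ((y (ee, i, j, false) : ℝ) : ℂ) + ((y (ee, i, j, true) : ℝ) : ℂ) * Complex.I) a.1)).prod).trace.re) (coords y) ∂(κ t x)) * (∫ y, (fun y : (Edge 3 L × Fin 2 × Fin 2 × Bool → ℝ) => ((l₂.map (fun a : Edge 3 L × Bool => if a.2 then ((fun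 (ee : Edge 3 L) => Matrix.of fun (i j : Fin 2) => ((y (ee, i, j, false) : ℝ) : ℂ) + ((y (ee, i, j, true) : ℝ) : ℂ) * Complex.I) a.1)ᴴ else (fun (ee : Edge 3 L) => Matrix.of fun (i j : Fin 2) => ((y (ee, i, j, false) : ℝ) : ℂ) + ((y (ee, i, j, true) : ℝ) : ℂ) * Complex.I) a.1)).prod).trace.re) (coords y) ∂(κ t x))| ≤
      384 * Real.pi ^ 2 * (l₁.length : ℝ) ^ 2 * (l₂.length : ℝ) ^ 2 * ((t : ℝ) * Real.exp (2 * ((|β'| * (4 + 4 * Real.sqrt 2 + 12 * 108)) * (t : ℝ))) * ((2 : ℝ)⁻¹) ^ (R + 1)) := by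
  intro coords
  classical
  set ℓF : Edge 3 L → ℝ := fun e => if e ∈ (l₁.map Prod.fst).toFinset then 2 * Real.pi * (l₁.length : ℝ) else 0 with hℓF
  set ℓG : Edge 3 L → ℝ := fun e => if e ∈ (l₂.map Prod.fst).toFinset then 2 * Real.pi * (l₂.length : ℝ) else 0 with hℓG
  have hℓF0 : ∀ e, 0 ≤ ℓF e := fun e => by
    simp only [hℓF]; split_ifs
    · positivity
    · exact le_rfl
  have hℓG0 : ∀ e, 0 ≤ ℓG e := fun e => by
    simp only [hℓG]; split_ifs
    · positivity
    · exact le_rfl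
  have hΛF : ∀ e, e ∉ (l₁.map Prod.fst).toFinset → ℓF e = 0 := fun e he => by simp only [hℓF, he, if_false]
  have hΛG : ∀ e, e ∉ (l₂.map Prod.fst).toFinset → ℓG e = 0 := fun e he => by simp only [hℓG, he, if_false]
  have hLf := word_linkLipschitz_profile L β' l₁
  have hLg := word_linkLipschitz_profile L β' l₂
  have key := transition_covariance_abs_le_lightCone_of_separated L β' κ hreal (contDiff_word (L := L) l₁ (m := 3)) hℓF0
    (contDiff_word (L := L) l₂ (m := 3)) hℓG0 (l₁.map Prod.fst).toFinset (l₂.map Prod.fst).toFinset hΛF hΛG R hsep t x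
    (fun e y y' h => hLf e y y' h) (fun e y y' h => hLg e y y' h)
  refine key.trans ?_
  have hsum : ∀ (l : List (Edge 3 L × Bool)),
      (∑ e : Edge 3 L, (if e ∈ (l.map Prod.fst).toFinset then 2 * Real.pi * (l.length : ℝ) else 0)) ≤ 2 * Real.pi * (l.length : ℝ) ^ 2 := by
    intro l
    have hcard : (((l.map Prod.fst).toFinset.card : ℕ) : ℝ) ≤ l.length := by
      have h1 := List.toFinset_card_le (l.map Prod.fst)
      rw [List.length_map] at h1
      exact_mod_cast h1
    rw [Finset.sum_ite_mem, Finset.univ_inter, Finset.sum_const, nsmul_eq_mul]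
    calc ((l.map Prod.fst).toFinset.card : ℝ) * (2 * Real.pi * (l.length : ℝ)) ≤ (l.length : ℝ) * (2 * Real.pi * (l.length : ℝ)) :=
        mul_le_mul_of_nonneg_right hcard (by positivity)
      _ = 2 * Real.pi * (l.length : ℝ) ^ 2 := by ring
  have hF := hsum l₁
  have hG := hsum l₂
  have hpre : 0 ≤ 96 * (t : ℝ) * Real.exp (2 * ((|β'| * (4 + 4 * Real.sqrt 2 + 12 * 108)) * (t : ℝ))) * ((2 : ℝ)⁻¹) ^ (R + 1) := by positivity
  have hSF : 0 ≤ ∑ e : Edge 3 L, ℓF e := Finset.sum_nonneg fun e _ => hℓF0 e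
  calc 96 * (t : ℝ) * Real.exp (2 * ((|β'| * (4 + 4 * Real.sqrt 2 + 12 * 108)) * (t : ℝ))) * ((2 : ℝ)⁻¹) ^ (R + 1) * (∑ e : Edge 3 L, ℓF e) * (∑ e : Edge 3 L, ℓG e)
      = 96 * (t : ℝ) * Real.exp (2 * ((|β'| * (4 + 4 * Real.sqrt 2 + 12 * 108)) * (t : ℝ))) * ((2 : ℝ)⁻¹) ^ (R + 1) * ((∑ e : Edge 3 L, ℓF e) * (∑ e : Edge 3 L, ℓG e)) := by ring
    _ ≤ 96 * (t : ℝ) * Real.exp (2 * ((|β'| * (4 + 4 * Real.sqrt 2 + 12 * 108)) * (t : ℝ))) * ((2 : ℝ)⁻¹) ^ (R + 1) * ((2 * Real.pi * (l₁.length : ℝ) ^ 2) * (2 * Real.pi * (l₂.length : ℝ) ^ 2)) :=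
        mul_le_mul_of_nonneg_left (mul_le_mul hF hG (Finset.sum_nonneg fun e _ => hℓG0 e) (by positivity)) hpre
    _ = _ := by ring

/-- ★★★ **Wilson loops ALONG EVERY SZZ SOLUTION from a deterministic start — in particular the COLD START `U_0 ≡ 1` of the route** (any
filtered probability space, any flat Brownian driver; EVERY coupling, every volume): for loop words `w₁, w₂` at cyclic sup-distance `≥ R+1`,
`|E[Re tr w₁(U_t)·Re tr w₂(U_t)] − E[Re tr w₁(U_t)]·E[Re tr w₂(U_t)]| ≤ 384π²·|w₁|²·|w₂|²·t·e^(2λt)·2^(−(R+1))`.  The cold start is a product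
state; the dynamics correlates two distant loops only after a lattice time `≈ (R+1) log 2/(2λ)`, uniformly in the volume.  Fixed cut-off; along
the route's scaling `β'_K → ∞` this is NO `K`-uniform statement in physical units; `UniformColdStartMixing` (24809) is NOT restated; the
Yang–Mills mass gap is NOT proved. [folklore] -/
theorem wilson_loop_solution_covariance_abs_le_lightCone (L : ℕ) [NeZero L] (β' : ℝ) (t : ℝ≥0)
    (x₀ : (GaugeConfig 3 L (Matrix.specialUnitaryGroup (Fin 2) ℂ)))
    (Ω : Type) [MeasurableSpace Ω] (P : Measure Ω) [IsProbabilityMeasure P]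
    (W : ℝ≥0 → Ω → (Edge 3 L × NoiseIdx 2 → ℝ)) (hW : IsFlatBrownian W P)
    (U : ℝ≥0 → Ω → (GaugeConfig 3 L (Matrix.specialUnitaryGroup (Fin 2) ℂ))) (hU0 : ∀ ω, U 0 ω = x₀)
    (hU : (latticeLangevinDynamics (fundamentalLatticeRep 2) β').IsSolution (fundamentalRep (Fin 2)) hW.natFiltration P W U)
    (l₁ l₂ : List (Edge 3 L × Bool)) (R : ℕ)
    (hsep : ∀ e' ∈ (l₁.map Prod.fst).toFinset, ∀ e ∈ (l₂.map Prod.fst).toFinset, R + 1 ≤ (Finset.univ.sup fun i : Fin 3 => ((e'.1 i - e.1 i).valMinAbs).natAbs)) :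
    let coords : GaugeConfig 3 L (Matrix.specialUnitaryGroup (Fin 2) ℂ) → (Edge 3 L × Fin 2 × Fin 2 × Bool → ℝ) :=
      fun V q => (fun z : ℂ => if q.2.2.2 then z.im else z.re)
        ((fundamentalRep (Fin 2) (V q.1) : Matrix (Fin 2) (Fin 2) ℂ) q.2.1 q.2.2.1)
    |(∫ ω, (fun y : (Edge 3 L × Fin 2 × Fin 2 × Bool → ℝ) => ((l₁.map (fun a : Edge 3 L × Bool => if a.2 then ((fun (ee : Edge 3 L) => Matrix.of fun (i j : Fin 2) => ((y (ee, i, j, false) : ℝ) : ℂ) + ((y (ee, i, j, true) : ℝ) : ℂ) * Complex.I) a.1)ᴴ else (fun (ee : Edge 3 L) => Matrix.of fun (i j : Fin 2) => ((y (ee, i, j, false) : ℝ) : ℂ) + ((y (ee, i, j, true) : ℝ) : ℂ) * Complex.I) a.1)).prod).trace.re) (coords (U t ω)) * (fun y : (Edge 3 L × Fin 2 × Fin 2 × Bool → ℝ) => ((l₂.map (fun a : Edge 3 L × Bool => if a.2 then ((fun (ee : Edge 3 L) => Matrix.of fun (i j : Fin 2) => ((y (ee, i, j, false) : ℝ) :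 ℂ) + ((y (ee, i, j, true) : ℝ) : ℂ) * Complex.I) a.1)ᴴ else (fun (ee : Edge 3 L) => Matrix.of fun (i j : Fin 2) => ((y (ee, i, j, false) : ℝ) : ℂ) + ((y (ee, i, j, true) : ℝ) : ℂ) * Complex.I) a.1)).prod).trace.re) (coords (U t ω)) ∂P) -
        (∫ ω, (fun y : (Edge 3 L × Fin 2 × Fin 2 × Bool → ℝ) => ((l₁.map (fun a : Edge 3 L × Bool => if a.2 then ((fun (ee : Edge 3 L) => Matrix.of fun (i j : Fin 2) => ((y (ee, i, j, false) : ℝ) : ℂ) + ((y (ee, i, j, true) : ℝ) : ℂ) * Complex.I) a.1)ᴴ else (fun (ee : Edge 3 L) => Matrix.of fun (i j : Fin 2) => ((y (ee, i, j, false) : ℝ) : ℂ) + ((y (ee, i, j, true) : ℝ) : ℂ) * Complex.I) a.1)).prod).trace.re) (coords (U t ω)) ∂P) * (∫ ω, (fun y : (Edge 3 L × Fin 2 × Fin 2 × Bool → ℝ) => ((l₂.map (fun a : Edge 3 L × Bool => if a.2 then ((fun (ee : Edge 3 L) => Matrix.of fun (i j : Fin 2) => ((y (ee, i, j, false) : ℝ)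 : ℂ) + ((y (ee, i, j, true) : ℝ) : ℂ) * Complex.I) a.1)ᴴ else (fun (ee : Edge 3 L) => Matrix.of fun (i j : Fin 2) => ((y (ee, i, j, false) : ℝ) : ℂ) + ((y (ee, i, j, true) : ℝ) : ℂ) * Complex.I) a.1)).prod).trace.re) (coords (U t ω)) ∂P)| ≤
      384 * Real.pi ^ 2 * (l₁.length : ℝ) ^ 2 * (l₂.length : ℝ) ^ 2 * ((t : ℝ) * Real.exp (2 * ((|β'| * (4 + 4 * Real.sqrt 2 + 12 * 108)) * (t : ℝ))) * ((2 : ℝ)⁻¹) ^ (R + 1)) := by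
  intro coords
  classical
  haveI := secondCountableTopology_su2
  haveI := borelSpace_config L
  obtain ⟨κ, hκ, -, hreal⟩ := exists_transitionKernel L β'
  haveI := hκ
  have h := wilson_loop_transition_covariance_abs_le_lightCone L β' κ hreal l₁ l₂ R hsep t x₀
  have hlaw : κ t x₀ = P.map (U t) := hreal t x₀ Ω P W hW U hU0 hU
  have hmU : Measurable (U t) := (hU.adapted t).mono (hW.natFiltration.le t) le_rfl
  have hco : Continuous coords := continuous_coords (L := L)
  have hFm : Measurable fun y : (GaugeConfig 3 L (Matrix.specialUnitaryGroup (Fin 2) ℂ)) => (fun y : (Edge 3 L × Fin 2 × Fin 2 × Bool → ℝ) => ((l₁.map (fun a : Edge 3 L × Bool => if a.2 then ((fun (ee : Edge 3 L) => Matrix.of fun (i j : Fin 2) => ((y (ee, i, j, false) : ℝ) : ℂ) + ((y (ee, i, j, true) : ℝ) : ℂ) * Complex.I) a.1)ᴴ else (fun (ee : Edge 3 L) => Matrix.of fun (i j : Fin 2) => ((y (ee, i, j, false) : ℝ) : ℂ) + ((y (ee, i, j, true) : ℝ) : ℂ) * Complex.I) a.1)).prod).trace.re) (coords y) :=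
    ((contDiff_word (L := L) l₁ (m := 3)).continuous.comp hco).measurable
  have hGm : Measurable fun y : (GaugeConfig 3 L (Matrix.specialUnitaryGroup (Fin 2) ℂ)) => (fun y : (Edge 3 L × Fin 2 × Fin 2 × Bool → ℝ) => ((l₂.map (fun a : Edge 3 L × Bool => if a.2 then ((fun (ee : Edge 3 L) => Matrix.of fun (i j : Fin 2) => ((y (ee, i, j, false) : ℝ) : ℂ) + ((y (ee, i, j, true) : ℝ) : ℂ) * Complex.I) a.1)ᴴ else (fun (ee : Edge 3 L) => Matrix.of fun (i j : Fin 2) => ((y (ee, i, j, false) : ℝ) : ℂ) + ((y (ee, i, j, true) : ℝ) : ℂ) * Complex.I) a.1)).prod).trace.re) (coords y) :=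
    ((contDiff_word (L := L) l₂ (m := 3)).continuous.comp hco).measurable
  have hFGm : Measurable fun y : (GaugeConfig 3 L (Matrix.specialUnitaryGroup (Fin 2) ℂ)) => (fun y : (Edge 3 L × Fin 2 × Fin 2 × Bool → ℝ) => ((l₁.map (fun a : Edge 3 L × Bool => if a.2 then ((fun (ee : Edge 3 L) => Matrix.of fun (i j : Fin 2) => ((y (ee, i, j, false) : ℝ) : ℂ) + ((y (ee, i, j, true) : ℝ) : ℂ) * Complex.I) a.1)ᴴ else (fun (ee : Edge 3 L) => Matrix.of fun (i j : Fin 2) => ((y (ee, i, j, false) : ℝ) : ℂ) + ((y (ee, i, j, true) : ℝ) : ℂ) * Complex.I) a.1)).prod).trace.re) (coords y) * (fun y : (Edge 3 L × Fin 2 × Fin 2 × Bool → ℝ) => ((l₂.map (fun a : Edge 3 L × Bool => if a.2 then ((fun (ee : Edge 3 L) => Matrix.of fun (i j : Fin 2) => ((y (ee, i, j, false) : ℝ) : ℂ) + ((y (ee, i, j, true) : ℝ) : ℂ) * Complex.I) a.1)ᴴ else (fun (ee : Edge 3 L) => Matrix.of fun (i j : Fin 2) => ((y (ee, i, j, false)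 : ℝ) : ℂ) + ((y (ee, i, j, true) : ℝ) : ℂ) * Complex.I) a.1)).prod).trace.re) (coords y) := hFm.mul hGm
  have e1 : ∫ y, (fun y : (Edge 3 L × Fin 2 × Fin 2 × Bool → ℝ) => ((l₁.map (fun a : Edge 3 L × Bool => if a.2 then ((fun (ee : Edge 3 L) => Matrix.of fun (i j : Fin 2) => ((y (ee, i, j, false) : ℝ) : ℂ) + ((y (ee, i, j, true) : ℝ) : ℂ) * Complex.I) a.1)ᴴ else (fun (ee : Edge 3 L) => Matrix.of fun (i j : Fin 2) => ((y (ee, i, j, false) : ℝ) : ℂ) + ((y (ee, i, j, true) : ℝ) : ℂ) * Complex.I) a.1)).prod).trace.re) (coords y) * (fun y : (Edge 3 L × Fin 2 × Fin 2 × Bool → ℝ) => ((l₂.map (fun a : Edge 3 L × Bool => if a.2 then ((fun (ee : Edge 3 L) => Matrix.of fun (i j : Fin 2) => ((y (ee, i, j, false) : ℝ) : ℂ) + ((y (ee, i, j, true) : ℝ) : ℂ) * Complex.I) a.1)ᴴ else (fun (ee : Edge 3 L) => Matrix.of fun (i j : Fin 2) => ((y (ee, i, j, false) : ℝ) : ℂ)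 + ((y (ee, i, j, true) : ℝ) : ℂ) * Complex.I) a.1)).prod).trace.re) (coords y) ∂(κ t x₀) = ∫ ω, (fun y : (Edge 3 L × Fin 2 × Fin 2 × Bool → ℝ) => ((l₁.map (fun a : Edge 3 L × Bool => if a.2 then ((fun (ee : Edge 3 L) => Matrix.of fun (i j : Fin 2) => ((y (ee, i, j, false) : ℝ) : ℂ) + ((y (ee, i, j, true) : ℝ) : ℂ) * Complex.I) a.1)ᴴ else (fun (ee : Edge 3 L) => Matrix.of fun (i j : Fin 2) => ((y (ee, i, j, false) : ℝ) : ℂ) + ((y (ee, i, j, true) : ℝ) : ℂ) * Complex.I) a.1)).prod).trace.re) (coords (U t ω)) * (fun y : (Edge 3 L × Fin 2 × Fin 2 × Bool → ℝ) => ((l₂.map (fun a : Edge 3 L × Bool => if a.2 then ((fun (ee : Edge 3 L) => Matrix.of fun (i j : Fin 2) => ((y (ee, i, j, false) : ℝ) : ℂ) + ((y (ee, i, j, true) : ℝ) : ℂ) * Complex.I) a.1)ᴴ else (fun (ee : Edge 3 L) => Matrix.of fun (i j : Fin 2) => ((y (ee, i, j, false) : ℝ) : ℂ) + ((y (ee,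 i, j, true) : ℝ) : ℂ) * Complex.I) a.1)).prod).trace.re) (coords (U t ω)) ∂P := by
    rw [hlaw, integral_map hmU.aemeasurable hFGm.aestronglyMeasurable]
  have e2 : ∫ y, (fun y : (Edge 3 L × Fin 2 × Fin 2 × Bool → ℝ) => ((l₁.map (fun a : Edge 3 L × Bool => if a.2 then ((fun (ee : Edge 3 L) => Matrix.of fun (i j : Fin 2) => ((y (ee, i, j, false) : ℝ) : ℂ) + ((y (ee, i, j, true) : ℝ) : ℂ) * Complex.I) a.1)ᴴ else (fun (ee : Edge 3 L) => Matrix.of fun (i j : Fin 2) => ((y (ee, i, j, false) : ℝ) : ℂ) + ((y (ee, i, j, true) : ℝ) : ℂ) * Complex.I) a.1)).prod).trace.re) (coords y) ∂(κ t x₀) = ∫ ω, (fun y : (Edge 3 L × Fin 2 × Fin 2 × Bool → ℝ) => ((l₁.map (fun a : Edge 3 L × Bool => if a.2 then ((fun (ee : Edge 3 L) => Matrix.of fun (i j : Fin 2) => ((y (ee, i, j, false) : ℝ) : ℂ) + ((y (ee, i, j, true) : ℝ) : ℂ) * Complex.I) a.1)ᴴ else (fun (ee : Edge 3 L) => Matrix.of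 fun (i j : Fin 2) => ((y (ee, i, j, false) : ℝ) : ℂ) + ((y (ee, i, j, true) : ℝ) : ℂ) * Complex.I) a.1)).prod).trace.re) (coords (U t ω)) ∂P := by
    rw [hlaw, integral_map hmU.aemeasurable hFm.aestronglyMeasurable]
  have e3 : ∫ y, (fun y : (Edge 3 L × Fin 2 × Fin 2 × Bool → ℝ) => ((l₂.map (fun a : Edge 3 L × Bool => if a.2 then ((fun (ee : Edge 3 L) => Matrix.of fun (i j : Fin 2) => ((y (ee, i, j, false) : ℝ) : ℂ) + ((y (ee, i, j, true) : ℝ) : ℂ) * Complex.I) a.1)ᴴ else (fun (ee : Edge 3 L) => Matrix.of fun (i j : Fin 2) => ((y (ee, i, j, false) : ℝ) : ℂ) + ((y (ee, i, j, true) : ℝ) : ℂ) * Complex.I) a.1)).prod).trace.re) (coords y) ∂(κ t x₀) = ∫ ω, (fun y : (Edge 3 L × Fin 2 × Fin 2 × Bool → ℝ) => ((l₂.map (fun a : Edge 3 L × Bool => if a.2 then ((fun (ee : Edge 3 L) => Matrix.of fun (i j : Fin 2) => ((y (ee, i, j, false) : ℝ) : ℂ) + ((y (ee, i, j, true) : ℝ)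 : ℂ) * Complex.I) a.1)ᴴ else (fun (ee : Edge 3 L) => Matrix.of fun (i j : Fin 2) => ((y (ee, i, j, false) : ℝ) : ℂ) + ((y (ee, i, j, true) : ℝ) : ℂ) * Complex.I) a.1)).prod).trace.re) (coords (U t ω)) ∂P := by
    rw [hlaw, integral_map hmU.aemeasurable hGm.aestronglyMeasurable]
  rw [← e1, ← e2, ← e3]
  exact h

/-! ## §2. Uniform in time: from a deterministic start, separated observables are NEVER correlated (`|β'| < 1/12`) -/

/-- **Polynomial × exponential.**  For `c, ρ > 0`-type data (`0 ≤ c`, `0 < ρ`) and `t ≥ 0`: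
`((c·t + 1)³ + 2)·e^(−ρt) ≤ (27·(1 + 2c/ρ)³ + 2)·e^(−ρt/2)` (`1 + u ≤ 3e^(u/3)`). [folklore] -/
theorem cube_add_two_mul_exp_neg_le {c ρ t : ℝ} (hc : 0 ≤ c) (hρ : 0 < ρ) (ht : 0 ≤ t) :
    ((c * t + 1) ^ 3 + 2) * Real.exp (-(ρ * t)) ≤ (27 * (1 + 2 * c / ρ) ^ 3 + 2) * Real.exp (-(ρ * t / 2)) := by
  set u : ℝ := ρ * t / 2 with hu
  have hu0 : 0 ≤ u := by positivity
  have hK0 : 0 ≤ 1 + 2 * c / ρ := by positivity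
  have h1 : c * t + 1 ≤ (1 + 2 * c / ρ) * (1 + u) := by
    have e : c * t = (2 * c / ρ) * u := by rw [hu]; field_simp
    rw [e]; nlinarith [mul_nonneg (div_nonneg (mul_nonneg zero_le_two hc) hρ.le) hu0, div_nonneg (mul_nonneg zero_le_two hc) hρ.le]
  have h2 : 1 + u ≤ 3 * Real.exp (u / 3) := by
    have := Real.add_one_le_exp (u / 3); linarith
  have h3 : (1 + u) ^ 3 ≤ 27 * Real.exp u := by
    have e : Real.exp u = Real.exp (u / 3) ^ 3 := by rw [← Real.exp_nat_mul]; congr 1; ring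
    rw [e]
    calc (1 + u) ^ 3 ≤ (3 * Real.exp (u / 3)) ^ 3 := pow_le_pow_left₀ (by linarith) h2 3
      _ = 27 * Real.exp (u / 3) ^ 3 := by ring
  have h4 : (c * t + 1) ^ 3 ≤ (1 + 2 * c / ρ) ^ 3 * (27 * Real.exp u) :=
    calc (c * t + 1) ^ 3 ≤ ((1 + 2 * c / ρ) * (1 + u)) ^ 3 := pow_le_pow_left₀ (by positivity) h1 3
      _ = (1 + 2 * c / ρ) ^ 3 * (1 + u) ^ 3 := by ring
      _ ≤ (1 + 2 * c / ρ) ^ 3 * (27 * Real.exp u) := mul_le_mul_of_nonneg_left h3 (pow_nonneg hK0 3)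
  have h5 : (2 : ℝ) ≤ 2 * Real.exp u := by
    have : 1 ≤ Real.exp u := Real.one_le_exp hu0
    linarith
  have hexp : Real.exp (-(ρ * t)) = Real.exp (-(ρ * t / 2)) * Real.exp (-u) := by
    rw [← Real.exp_add]; congr 1; rw [hu]; ring
  have hexpu : Real.exp u * Real.exp (-u) = 1 := by rw [← Real.exp_add, add_neg_cancel, Real.exp_zero]
  have hpos : 0 < Real.exp (-(ρ * t / 2)) := Real.exp_pos _
  rw [hexp]
  calc ((c * t + 1) ^ 3 + 2) * (Real.exp (-(ρ * t / 2)) * Real.exp (-u))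
      ≤ ((1 + 2 * c / ρ) ^ 3 * (27 * Real.exp u) + 2 * Real.exp u) * (Real.exp (-(ρ * t / 2)) * Real.exp (-u)) :=
        mul_le_mul_of_nonneg_right (add_le_add h4 h5) (by positivity)
    _ = (27 * (1 + 2 * c / ρ) ^ 3 + 2) * Real.exp (-(ρ * t / 2)) * (Real.exp u * Real.exp (-u)) := by ring
    _ = (27 * (1 + 2 * c / ρ) ^ 3 + 2) * Real.exp (-(ρ * t / 2)) := by rw [hexpu, mul_one]

/-- **The crossover bookkeeping** (pure real arithmetic).  If a quantity `C` obeys the light-cone bound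
`C ≤ 96·t·e^(2λt)·2^(−(R+1))·S_F·S_G` and the mixing bound `C ≤ 8S_FS_G(1+T_R)e^(−ρT_R) + 12π((3(λ+ρ)t+1)³+2)e^(−ρt)·Amp` at some `t ≥ 0`
(`T_R = (R+1) log 108/(λ+ρ)`, `λ ≥ 0`, `ρ > 0`), then `C ≤ (96t⋆S_FS_G + 8S_FS_G(1+T_R) + 12π(27(1+6(λ+ρ)/ρ)³+2)Amp)·e^(−ρt⋆/2)`,
`t⋆ = (R+1) log 2/(2λ+ρ)`: for `t ≤ t⋆` use the first bound (`e^(2λt⋆)2^(−(R+1)) = e^(−ρt⋆)`), for `t ≥ t⋆` the second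
(`T_R ≥ t⋆/2`, `cube_add_two_mul_exp_neg_le`). [folklore] -/
theorem crossover_bound_of_two_regimes {lam rho t SF SG Amp C : ℝ} (hlam0 : 0 ≤ lam) (hrho0 : 0 < rho) (ht : 0 ≤ t)
    (hSF0 : 0 ≤ SF) (hSG0 : 0 ≤ SG) (hAmp0 : 0 ≤ Amp) (R : ℕ)
    (h35 : C ≤ 96 * t * Real.exp (2 * (lam * t)) * ((2 : ℝ)⁻¹) ^ (R + 1) * SF * SG)
    (h18 : C ≤ 8 * SF * SG * (1 + (((R : ℝ) + 1) * Real.log 108 / (lam + rho))) * Real.exp (-(rho * (((R : ℝ) + 1) * Real.log 108 / (lam + rho)))) +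
      12 * Real.pi * ((3 * ((lam + rho) * t) + 1) ^ 3 + 2) * Real.exp (-(rho * t)) * Amp) :
    C ≤ (96 * (((R : ℝ) + 1) * Real.log 2 / (2 * lam + rho)) * SF * SG + 8 * SF * SG * (1 + (((R : ℝ) + 1) * Real.log 108 / (lam + rho))) + 12 * Real.pi * (27 * (1 + 6 * (lam + rho) / rho) ^ 3 + 2) * Amp) * Real.exp (-(rho * (((R : ℝ) + 1) * Real.log 2 / (2 * (2 * lam + rho))))) := by
  obtain ⟨TR, hTR⟩ : ∃ TR : ℝ, TR = (((R : ℝ) + 1) * Real.log 108 / (lam + rho)) := ⟨_, rfl⟩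
  obtain ⟨ts, hts⟩ : ∃ ts : ℝ, ts = (((R : ℝ) + 1) * Real.log 2 / (2 * lam + rho)) := ⟨_, rfl⟩
  obtain ⟨E, hE⟩ : ∃ E : ℝ, E = Real.exp (-(rho * (((R : ℝ) + 1) * Real.log 2 / (2 * (2 * lam + rho))))) := ⟨_, rfl⟩
  obtain ⟨K3, hK3⟩ : ∃ K3 : ℝ, K3 = (27 * (1 + 6 * (lam + rho) / rho) ^ 3 + 2) := ⟨_, rfl⟩
  rw [← hTR] at h18
  rw [← hTR, ← hts, ← hE, ← hK3]
  have hden1 : 0 < lam + rho := by linarith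
  have hden2 : 0 < 2 * lam + rho := by linarith
  have hlog2 : 0 < Real.log 2 := Real.log_pos (by norm_num)
  have hlog108 : 0 < Real.log 108 := Real.log_pos (by norm_num)
  have hR1 : 0 < (R : ℝ) + 1 := by positivity
  have hts0 : 0 ≤ ts := by rw [hts]; positivity
  have hTR0 : 0 ≤ TR := by rw [hTR]; positivity
  have hE0 : 0 < E := by rw [hE]; exact Real.exp_pos _
  have hK30 : 0 ≤ K3 := by rw [hK3]; positivity
  have hEts : E = Real.exp (-(rho * ts / 2)) := by
    rw [hE, hts]; congr 1; field_simp
  have hgoal : (96 * ts * SF * SG + 8 * SF * SG * (1 + TR) + 12 * Real.pi * K3 * Amp) * E =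
      96 * ts * E * SF * SG + (8 * SF * SG * (1 + TR) * E + 12 * Real.pi * K3 * E * Amp) := by ring
  have hP1 : 0 ≤ 96 * ts * E * SF * SG := by positivity
  have hP2 : 0 ≤ 8 * SF * SG * (1 + TR) * E := by positivity
  have hP3 : 0 ≤ 12 * Real.pi * K3 * E * Amp := by positivity
  rw [hgoal]
  rcases le_total t ts with hle | hge
  · -- before the crossover
    have hpow : ((2 : ℝ)⁻¹) ^ (R + 1) = Real.exp (-(((R : ℝ) + 1) * Real.log 2)) := by
      rw [Real.exp_neg, show ((R : ℝ) + 1) = ((R + 1 : ℕ) : ℝ) by push_cast; ring, Real.exp_nat_mul, Real.exp_log (by norm_num : (0:ℝ) < 2), inv_pow]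
    have hcross : Real.exp (2 * (lam * ts)) * ((2 : ℝ)⁻¹) ^ (R + 1) = Real.exp (-(rho * ts)) := by
      rw [hpow, ← Real.exp_add]; congr 1
      have e : ((R : ℝ) + 1) * Real.log 2 = (2 * lam + rho) * ts := by rw [hts]; field_simp
      rw [e]; ring
    have h1 : Real.exp (2 * (lam * t)) ≤ Real.exp (2 * (lam * ts)) :=
      Real.exp_le_exp.2 (mul_le_mul_of_nonneg_left (mul_le_mul_of_nonneg_left hle hlam0) (by norm_num))
    have h2 : Real.exp (-(rho * ts)) ≤ E := by
      have hm := mul_nonneg hrho0.le hts0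
      rw [hEts, Real.exp_le_exp]; linarith only [hm]
    have hmono : t * Real.exp (2 * (lam * t)) * ((2 : ℝ)⁻¹) ^ (R + 1) ≤ ts * E :=
      calc t * Real.exp (2 * (lam * t)) * ((2 : ℝ)⁻¹) ^ (R + 1) ≤ ts * Real.exp (2 * (lam * ts)) * ((2 : ℝ)⁻¹) ^ (R + 1) :=
            mul_le_mul_of_nonneg_right (mul_le_mul hle h1 (Real.exp_nonneg _) hts0) (by positivity)
        _ = ts * Real.exp (-(rho * ts)) := by rw [mul_assoc, hcross]
        _ ≤ ts * E := mul_le_mul_of_nonneg_left h2 hts0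
    calc C ≤ 96 * t * Real.exp (2 * (lam * t)) * ((2 : ℝ)⁻¹) ^ (R + 1) * SF * SG := h35
      _ = 96 * (t * Real.exp (2 * (lam * t)) * ((2 : ℝ)⁻¹) ^ (R + 1)) * (SF * SG) := by ring
      _ ≤ 96 * (ts * E) * (SF * SG) := mul_le_mul_of_nonneg_right (mul_le_mul_of_nonneg_left hmono (by norm_num)) (mul_nonneg hSF0 hSG0)
      _ = 96 * ts * E * SF * SG := by ring
      _ ≤ _ := le_add_of_nonneg_right (add_nonneg hP2 hP3)
  · -- after the crossover
    have h8 : 0 ≤ 8 * SF * SG * (1 + TR) := by positivity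
    have hpi : 0 ≤ 12 * Real.pi * Amp := by positivity
    have hTRts : ts / 2 ≤ TR := by
      rw [hts, hTR, div_div, div_le_div_iff₀ (by positivity) hden1]
      have hl : Real.log 2 ≤ Real.log 108 := Real.log_le_log (by norm_num) (by norm_num)
      nlinarith [mul_nonneg hR1.le hlog2.le, mul_nonneg hR1.le (sub_nonneg.2 hl), hlam0, hrho0.le]
    have hstat : Real.exp (-(rho * TR)) ≤ E := by
      have hm := mul_le_mul_of_nonneg_left hTRts hrho0.le
      rw [hEts, Real.exp_le_exp]; linarith only [hm]
    have htr : ((3 * ((lam + rho) * t) + 1) ^ 3 + 2) * Real.exp (-(rho * t)) ≤ K3 * E := by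
      have h1 := cube_add_two_mul_exp_neg_le (c := 3 * (lam + rho)) (ρ := rho) (t := t) (by positivity) hrho0 ht
      have e1 : (3 * (lam + rho)) * t = 3 * ((lam + rho) * t) := by ring
      have e2 : (27 * (1 + 2 * (3 * (lam + rho)) / rho) ^ 3 + 2) = K3 := by rw [hK3]; ring
      rw [e1, e2] at h1
      have h2 : Real.exp (-(rho * t / 2)) ≤ E := by
        have hm := mul_le_mul_of_nonneg_left hge hrho0.le
        rw [hEts, Real.exp_le_exp]; linarith only [hm]
      exact h1.trans (mul_le_mul_of_nonneg_left h2 hK30)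
    -- make the transcendental atoms opaque, then linear arithmetic
    have hA := mul_le_mul_of_nonneg_left hstat h8
    have hB := mul_le_mul_of_nonneg_left htr hpi
    obtain ⟨P, hP⟩ : ∃ P : ℝ, ((3 * ((lam + rho) * t) + 1) ^ 3 + 2) = P := ⟨_, rfl⟩
    obtain ⟨eT, heT⟩ : ∃ eT : ℝ, Real.exp (-(rho * t)) = eT := ⟨_, rfl⟩
    obtain ⟨eR, heR⟩ : ∃ eR : ℝ, Real.exp (-(rho * TR)) = eR := ⟨_, rfl⟩
    rw [hP, heT, heR] at h18
    rw [hP, heT] at hB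
    rw [heR] at hA
    clear hP heT heR hEts hE hK3 hTR hts h35 hTRts htr hstat
    linarith only [hA, hB, hP1, h18]

/-- ★★★ **UNIFORM-IN-TIME DYNAMIC CLUSTERING FROM EVERY DETERMINISTIC START** (`|β'| < 1/12`, every volume `L`).  For `C⁵` functions
`f, g` of the real link coordinates with bounds `M_F, M_G` and link-Lipschitz profiles `ℓ^F, ℓ^G` supported on link sets `Λ_F, Λ_G` whose base
sites are at cyclic sup-distance `≥ R+1`, for every realising kernel family, EVERY lattice time `t ≥ 0` and EVERY start `x` (e.g. the cold start):
`|κ_t(FG)(x) − κ_tF(x)·κ_tG(x)| ≤ (96·t⋆·Σℓ^FΣℓ^G + 8Σℓ^FΣℓ^G(1+T_R) + 12π(27(1+6(λ+ρ)/ρ)³+2)·Amp)·e^(−ρ·t⋆/2)`,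
`t⋆ = (R+1) log 2/(2λ+ρ)` (the crossover time: `e^(2λt⋆)·2^(−(R+1)) = e^(−ρt⋆)`), `T_R = (R+1) log 108/(λ+ρ)`, `ρ = 1 − 12|β'|`,
`λ = (1300+4√2)|β'|`, `Amp = #(Λ_F∪Λ_G)√Σ(M_Fℓ^G+M_Gℓ^F)² + M_G#Λ_F√Σ(ℓ^F)² + M_F#Λ_G√Σ(ℓ^G)²` — a bound DECAYING EXPONENTIALLY IN THE
SEPARATION `R` (rate `ρ log 2/(2(2λ+ρ))` per unit distance), with NO volume factor and NO time dependence: before `t⋆` the light cone of file 35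
(`transition_covariance_abs_le_lightCone_of_separated`) applies, after `t⋆` the transient of file 18 (`transition_covariance_abs_le_of_separated`) has
decayed and the static clustering term is `≤ e^(−ρT_R) ≤ e^(−ρt⋆/2)`.  Along the cold-start evolution at strong coupling, distant local observables
are uncorrelated AT ALL TIMES, uniformly in the volume.  Fixed cut-off, fixed window `|β'| < 1/12` (left by the route's `β'_K → ∞`);
`UniformColdStartMixing` (24809) is NOT restated; the Yang–Mills mass gap is NOT proved. [folklore] -/
theorem transition_covariance_abs_le_uniform_of_separated (L : ℕ) [NeZero L] (β' : ℝ) (hβ : |β'| < 1 / 12)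
    (κ : ℝ≥0 → Kernel (GaugeConfig 3 L (Matrix.specialUnitaryGroup (Fin 2) ℂ))
      (GaugeConfig 3 L (Matrix.specialUnitaryGroup (Fin 2) ℂ))) [∀ t, IsMarkovKernel (κ t)]
    (hreal : ∀ (t : ℝ≥0) (x : GaugeConfig 3 L (Matrix.specialUnitaryGroup (Fin 2) ℂ))
        (Ω : Type) [MeasurableSpace Ω] (P : Measure Ω) [IsProbabilityMeasure P]
        (W : ℝ≥0 → Ω → (Edge 3 L × NoiseIdx 2 → ℝ)) (hW : IsFlatBrownian W P)
        (U : ℝ≥0 → Ω → GaugeConfig 3 L (Matrix.specialUnitaryGroup (Fin 2) ℂ)),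
        (∀ ω, U 0 ω = x) →
        (latticeLangevinDynamics (fundamentalLatticeRep 2) β').IsSolution (fundamentalRep (Fin 2))
          hW.natFiltration P W U →
        κ t x = P.map (U t))
    {f : (Edge 3 L × Fin 2 × Fin 2 × Bool → ℝ) → ℝ} (hf : ContDiff ℝ 5 f) {ℓF : Edge 3 L → ℝ} (hℓF : ∀ e, 0 ≤ ℓF e) {MF : ℝ}
    {g : (Edge 3 L × Fin 2 × Fin 2 × Bool → ℝ) → ℝ} (hg : ContDiff ℝ 5 g) {ℓG : Edge 3 L → ℝ} (hℓG : ∀ e, 0 ≤ ℓG e) {MG : ℝ}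
    (Λf Λg : Finset (Edge 3 L)) (hΛf : ∀ e, e ∉ Λf → ℓF e = 0) (hΛg : ∀ e, e ∉ Λg → ℓG e = 0) (R : ℕ)
    (hsep : ∀ e' ∈ Λf, ∀ e ∈ Λg, R + 1 ≤ (Finset.univ.sup fun i : Fin 3 => ((e'.1 i - e.1 i).valMinAbs).natAbs)) (t : ℝ≥0) (x : GaugeConfig 3 L (Matrix.specialUnitaryGroup (Fin 2) ℂ)) :
    let coords : GaugeConfig 3 L (Matrix.specialUnitaryGroup (Fin 2) ℂ) → (Edge 3 L × Fin 2 × Fin 2 × Bool → ℝ) :=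
      fun V q => (fun z : ℂ => if q.2.2.2 then z.im else z.re)
        ((fundamentalRep (Fin 2) (V q.1) : Matrix (Fin 2) (Fin 2) ℂ) q.2.1 q.2.2.1)
    (∀ y, |f (coords y)| ≤ MF) → (∀ y, |g (coords y)| ≤ MG) →
    (∀ (e : Edge 3 L) (y y' : (GaugeConfig 3 L (Matrix.specialUnitaryGroup (Fin 2) ℂ))), (∀ f', f' ≠ e → y f' = y' f') →
      |f (coords y) - f (coords y')| ≤ ℓF e * frobNorm ((y e : Matrix (Fin 2) (Fin 2) ℂ) - (y' e : Matrix (Fin 2) (Fin 2) ℂ))) →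
    (∀ (e : Edge 3 L) (y y' : (GaugeConfig 3 L (Matrix.specialUnitaryGroup (Fin 2) ℂ))), (∀ f', f' ≠ e → y f' = y' f') →
      |g (coords y) - g (coords y')| ≤ ℓG e * frobNorm ((y e : Matrix (Fin 2) (Fin 2) ℂ) - (y' e : Matrix (Fin 2) (Fin 2) ℂ))) →
    |(∫ y, f (coords y) * g (coords y) ∂(κ t x)) - (∫ y, f (coords y) ∂(κ t x)) * (∫ y, g (coords y) ∂(κ t x))| ≤
      (96 * (((R : ℝ) + 1) * Real.log 2 / (2 * ((1300 + 4 * Real.sqrt 2) * |β'|) + (1 - 12 * |β'|))) * (∑ e : Edge 3 L, ℓF e) * (∑ e : Edge 3 L, ℓG e) + 8 * (∑ e : Edge 3 L, ℓF e) * (∑ e : Edge 3 L, ℓG e) * (1 + (((R : ℝ) + 1) * Real.log 108 / (((1300 + 4 * Real.sqrt 2) * |β'|) + (1 - 12 * |β'|)))) + 12 * Real.pi * (27 * (1 + 6 * (((1300 + 4 * Real.sqrt 2) * |β'|) + (1 - 12 * |β'|)) / (1 - 12 * |β'|)) ^ 3 + 2) * (((Λf ∪ Λg).card : ℝ) * Real.sqrt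 (∑ e : Edge 3 L, (MF * ℓG e + MG * ℓF e) ^ 2) + MG * (Λf.card : ℝ) * Real.sqrt (∑ e : Edge 3 L, ℓF e ^ 2) + MF * (Λg.card : ℝ) * Real.sqrt (∑ e : Edge 3 L, ℓG e ^ 2))) * Real.exp (-((1 - 12 * |β'|) * (((R : ℝ) + 1) * Real.log 2 / (2 * (2 * ((1300 + 4 * Real.sqrt 2) * |β'|) + (1 - 12 * |β'|)))))) := by
  intro coords hMF hMG hLf hLg
  have h35 := transition_covariance_abs_le_lightCone_of_separated L β' κ hreal (hf.of_le (by norm_num)) hℓF (hg.of_le (by norm_num)) hℓG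
    Λf Λg hΛf hΛg R hsep t x hLf hLg
  have hlam' : |β'| * (4 + 4 * Real.sqrt 2 + 12 * 108) = (1300 + 4 * Real.sqrt 2) * |β'| := by ring
  rw [hlam'] at h35
  have h18 := transition_covariance_abs_le_of_separated L β' hβ κ hreal hf hℓF hg hℓG Λf Λg hΛf hΛg R hsep t x hMF hMG hLf hLg
  have hlam0 : 0 ≤ (1300 + 4 * Real.sqrt 2) * |β'| := by positivity
  have hrho0 : 0 < 1 - 12 * |β'| := by linarith
  have hMF0 : 0 ≤ MF := (abs_nonneg _).trans (hMF x)
  have hMG0 : 0 ≤ MG := (abs_nonneg _).trans (hMG x)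
  exact crossover_bound_of_two_regimes hlam0 hrho0 t.coe_nonneg (Finset.sum_nonneg fun e _ => hℓF e) (Finset.sum_nonneg fun e _ => hℓG e)
    (by positivity) R h35 h18

end Summit.QuantumFields.YangMills.Theorems.ColdStartUniversality.LiebRobinson

end
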